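import Mathlib
import Literature.Probability.MarkovChains.TotalVariation
import Literature.Probability.Entropy.PinskerInequality
import Summits.Ventures.LatticeQCDFlow.Exactness.FlowMCMC
import Summits.Ventures.LatticeQCDFlow.Exactness.JarzynskiFinite
import Summits.Ventures.LatticeQCDFlow.Scaling.Acceptance
import Summits.Ventures.LatticeQCDFlow.Scaling.AcceptancePinskerFloor
import Summits.Ventures.LatticeQCDFlow.Scaling.AnnealingStepLaw
import Summits.Ventures.LatticeQCDFlow.Scaling.ImportanceWeights
import Summits.Ventures.LatticeQCDFlow.Scaling.StochasticFlows
import Summits.Ventures.LatticeQCDFlow.Scaling.VarianceLaws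

/-!
# LatticeQCDFlow / Scaling — acceptance TRANSFER: the equilibrium independence-Metropolis acceptance
# is concave and `2·TV`-Lipschitz in the target and in the model (constant `2` sharp); along a
# Gibbs ladder a trained model's acceptance is carried to the next coupling up to `√J`

HONEST FRAMING: exact (Metropolis-corrected) sampling algorithms for lattice gauge theory;
figures of merit are autocorrelation/cost numbers at stated couplings and volumes; no
continuum-physics claim.

Venture `LatticeQCDFlow` (cell pub-lqcd), topic `Scaling`; FANOUT row 3 (`s0-u1-a`, S0-B
implementation A, GEN-5).  NEW WORK of the cell, not a published result; NO definition is
introduced (the objects are the tree's `Exactness.accRate`, `Theory2.mixLaw`, `Theory2.klFin`,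
`Exactness.gibbsLaw`, `Literature…tvDist`).  Companion of row 3's `Scaling/AcceptancePinskerFloor`
(`acc ≥ 1 − √(2·D_KL(q‖p))`, the training objective floors the acceptance of ONE model against ONE
target).  This file answers the next question a bootstrapped training ladder raises — arm A trained
β = 3 to its budget and initialised β ∈ {1, 2, 4, 5, 6} from those weights, and monitored an
acceptance estimate checkpoint by checkpoint: HOW MUCH OF A MEASURED ACCEPTANCE SURVIVES when the
target (the coupling) or the model (the checkpoint) moves?

## Content (`acc(p, q) = Σ_x Σ_y min(p x q y, p y q x)`, the tree's `accRate`)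

* `accRate_nonneg`; **concavity** `accRate_mixLaw_left_ge` / `accRate_mixLaw_right_ge`:
  `acc((1−θ)p + θp', q) ≥ (1−θ)·acc(p, q) + θ·acc(p', q)` and the same in the model slot — purely
  algebraic (no normalisation needed); corollary `one_sub_mul_accRate_le_accRate_mixLaw`: a
  DEFENSIVE MIXTURE proposal `(1−θ)q + θr` (any law `r`) keeps at least `(1−θ)` of the flow's
  acceptance (generalises the tree's mixture floor `le_accRate_of_mul_le` to the model slot).
* `abs_tvDist_sub_tvDist_le` (reverse triangle inequality for `‖·‖_TV` in both slots);
  **transfer law** `abs_accRate_sub_accRate_le_two_mul_tvDist` (target slot),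
  `abs_accRate_sub_accRate_le_two_mul_tvDist_right` (model slot), `abs_accRate_sub_accRate_le`
  (both): `|acc(p, q) − acc(p', q')| ≤ 2‖p − p'‖_TV + 2‖q − q'‖_TV`; one-sided readable form
  `accRate_sub_two_mul_tvDist_le_accRate` (`acc(p', q) ≥ acc(p, q) − 2‖p − p'‖_TV`).  Proof: the
  tree's identity `acc = 1 − ‖p⊗q − q⊗p‖_TV` (`accRate_eq_one_sub_tvDist_prodLaw`) and blindness of
  `TV` to a common independent factor (`tvDist_prodLaw_left/right`).
* **sharpness of the constant `2`** (`accRate_transfer_witness`, `accRate_transfer_two_sharp`): on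
  `Fin 2 ⊕ Fin n` with `q = p` uniform and `p'` = uniform with mass `ε` moved from one point to
  another, `acc(p, q) − acc(p', q) = 2·((n+1)/(n+2))·‖p − p'‖_TV`; hence NO constant `C < 2` works.
* **Gibbs ladder** (`two_mul_tvDist_le_sqrt_jeffreys`: Pinsker both ways, `2‖p − q‖_TV ≤ √J(p, q)`,
  `J = D(p‖q) + D(q‖p)` [cite: PolyanskiyWu2024, Thm 7.10 via the tree's
  `Literature.Probability.Entropy.two_mul_tvDist_sq_le_kl`]; `accRate_gibbs_transfer`,
  `accRate_gibbs_transfer_linear`): for actions `S₀`, `S₁` on a finite configuration space and ANY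
  normalised model `q`,
  `acc(π_{S₁}, q) ≥ acc(π_{S₀}, q) − √(Σ_x (π_{S₀} x − π_{S₁} x)(S₁ x − S₀ x))`, and for a linear step
  `S₁ = S₀ + h·A`: `acc(π_{β+h}, q) ≥ acc(π_β, q) − √(h·(⟨A⟩_β − ⟨A⟩_{β+h}))` (the Jeffreys
  divergence of the tree's `jeffreys_gibbs`, T2-AD).

Reading (value-free; no number of record moves, nothing is re-scored): `⟨A⟩_β − ⟨A⟩_{β+h}` is
`h` times a susceptibility, extensive in the volume, so the acceptance a trained model is GUARANTEED
to carry to a neighbouring coupling without re-training survives only inside the window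
`|h| ≲ Δacc/√(V·χ_A)` — the same `V^{−1/2}` window as the reweighting window of
`Scaling/AnnealingStepLaw` (`ess_step_le`, T2-AA), now for the Metropolis acceptance instead of the
ESS; a unit step in `β` at `16²` lies far outside it, i.e. the warm start of a bootstrapped ladder
carries NO acceptance guarantee at that step and each rung has to be re-trained (as arm A's protocol
did).  In the model slot the law reads: two checkpoints whose equilibrium acceptances differ by `Δ`
are at least `Δ/2` apart in total variation.  NOT CLAIMED: any value of `χ_A`, `V`, or of an
acceptance of ours; the sampling error of a finite-sample acceptance MONITOR (the law is about the
equilibrium acceptance `accRate`, an expectation); anything about `τ_int`, ESS or per-sector weights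
(acceptance is blind to them: `Scaling/Acceptance.lean`, `acceptance_blind`); that `√J` is the best
ladder constant (only the `2` of the TV law is shown sharp).

Elementary (`[folklore]`-level); farm `lean check` rc 0, no `sorry`.
-/

namespace Summit.Ventures.LatticeQCDFlow.Theory2

open Finset
open Literature.Probability.MarkovChains
open Summit.Ventures.LatticeQCDFlow.Exactness

variable {X : Type*} [Fintype X]

/-! ### Positivity and concavity -/

/-- The equilibrium acceptance of non-negative laws is non-negative. [folklore] -/
theorem accRate_nonneg {p q : X → ℝ} (hp : ∀ x, 0 ≤ p x) (hq : ∀ x, 0 ≤ q x) :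
    0 ≤ accRate p q :=
  sum_nonneg fun x _ => sum_nonneg fun y _ =>
    le_min (mul_nonneg (hp x) (hq y)) (mul_nonneg (hp y) (hq x))

/-- Pointwise concavity of `min` along a convex combination. -/
private theorem convexComb_min_le {θ a b c d : ℝ} (h0 : 0 ≤ θ) (h1 : θ ≤ 1) :
    (1 - θ) * min a b + θ * min c d ≤ min ((1 - θ) * a + θ * c) ((1 - θ) * b + θ * d) := by
  rw [mul_min_of_nonneg a b (sub_nonneg.mpr h1), mul_min_of_nonneg c d h0]
  exact min_add_min_le_min_add_add

/-- **Concavity in the target.**  `acc((1−θ)p + θp', q) ≥ (1−θ)·acc(p, q) + θ·acc(p', q)` for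
`θ ∈ [0, 1]` — no sign or normalisation hypothesis is needed. [folklore] -/
theorem accRate_mixLaw_left_ge (p p' q : X → ℝ) {θ : ℝ} (h0 : 0 ≤ θ) (h1 : θ ≤ 1) :
    (1 - θ) * accRate p q + θ * accRate p' q ≤ accRate (mixLaw θ p p') q := by
  unfold accRate mixLaw
  rw [mul_sum, mul_sum, ← sum_add_distrib]
  refine sum_le_sum fun x _ => ?_
  rw [mul_sum, mul_sum, ← sum_add_distrib]
  refine sum_le_sum fun y _ => ?_
  have e1 : ((1 - θ) * p x + θ * p' x) * q y = (1 - θ) * (p x * q y) + θ * (p' x * q y) := by ring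
  have e2 : ((1 - θ) * p y + θ * p' y) * q x = (1 - θ) * (p y * q x) + θ * (p' y * q x) := by ring
  rw [e1, e2]
  exact convexComb_min_le h0 h1

/-- **Concavity in the model.**  `acc(p, (1−θ)q + θq') ≥ (1−θ)·acc(p, q) + θ·acc(p, q')` for
`θ ∈ [0, 1]`. [folklore] -/
theorem accRate_mixLaw_right_ge (p q q' : X → ℝ) {θ : ℝ} (h0 : 0 ≤ θ) (h1 : θ ≤ 1) :
    (1 - θ) * accRate p q + θ * accRate p q' ≤ accRate p (mixLaw θ q q') := by
  rw [accRate_comm p q, accRate_comm p q', accRate_comm p (mixLaw θ q q')]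
  exact accRate_mixLaw_left_ge q q' p h0 h1

/-- **Defensive mixture proposal.**  Mixing ANY non-negative law `r` into the proposal with weight
`θ ∈ [0, 1]` keeps at least the fraction `1 − θ` of the acceptance:
`(1−θ)·acc(p, q) ≤ acc(p, (1−θ)q + θr)`. [folklore] -/
theorem one_sub_mul_accRate_le_accRate_mixLaw {p q r : X → ℝ} {θ : ℝ} (h0 : 0 ≤ θ) (h1 : θ ≤ 1)
    (hp : ∀ x, 0 ≤ p x) (hr : ∀ x, 0 ≤ r x) :
    (1 - θ) * accRate p q ≤ accRate p (mixLaw θ q r) := by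
  have h := accRate_mixLaw_right_ge p q r h0 h1
  have h' : 0 ≤ θ * accRate p r := mul_nonneg h0 (accRate_nonneg hp hr)
  linarith

/-! ### The transfer law: `acc` is `2·TV`-Lipschitz in each slot -/

omit [Fintype X] in
/-- Reverse triangle inequality for the total-variation distance in both arguments. [folklore] -/
theorem abs_tvDist_sub_tvDist_le [Fintype X] (a b a' b' : X → ℝ) :
    |tvDist a b - tvDist a' b'| ≤ tvDist a a' + tvDist b b' := by
  rw [abs_sub_le_iff]
  constructor
  · have h1 := tvDist_triangle a a' b
    have h2 := tvDist_triangle a' b' b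
    rw [tvDist_comm b' b] at h2
    linarith
  · have h1 := tvDist_triangle a' a b'
    have h2 := tvDist_triangle a b b'
    rw [tvDist_comm a' a] at h1
    linarith

/-- **Transfer law, target slot.**  `|acc(p, q) − acc(p', q)| ≤ 2‖p − p'‖_TV` for normalised
`p`, `p'` and a non-negative normalised model `q`. [folklore] -/
theorem abs_accRate_sub_accRate_le_two_mul_tvDist {p p' q : X → ℝ} (hp1 : ∑ x, p x = 1)
    (hp'1 : ∑ x, p' x = 1) (hq : ∀ x, 0 ≤ q x) (hq1 : ∑ x, q x = 1) :
    |accRate p q - accRate p' q| ≤ 2 * tvDist p p' := by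
  rw [accRate_eq_one_sub_tvDist_prodLaw hp1 hq1, accRate_eq_one_sub_tvDist_prodLaw hp'1 hq1]
  have h := abs_tvDist_sub_tvDist_le (prodLaw p' q) (prodLaw q p') (prodLaw p q) (prodLaw q p)
  rw [tvDist_prodLaw_right p' p hq hq1, tvDist_prodLaw_left hq hq1 p' p, tvDist_comm p' p] at h
  have e : (1 - tvDist (prodLaw p q) (prodLaw q p)) - (1 - tvDist (prodLaw p' q) (prodLaw q p')) =
      tvDist (prodLaw p' q) (prodLaw q p') - tvDist (prodLaw p q) (prodLaw q p) := by ring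
  rw [e, two_mul]
  exact h

/-- **Transfer law, model slot.**  `|acc(p, q) − acc(p, q')| ≤ 2‖q − q'‖_TV` for a non-negative
normalised target `p` and normalised models `q`, `q'`. [folklore] -/
theorem abs_accRate_sub_accRate_le_two_mul_tvDist_right {p q q' : X → ℝ} (hp : ∀ x, 0 ≤ p x)
    (hp1 : ∑ x, p x = 1) (hq1 : ∑ x, q x = 1) (hq'1 : ∑ x, q' x = 1) :
    |accRate p q - accRate p q'| ≤ 2 * tvDist q q' := by
  rw [accRate_comm p q, accRate_comm p q']
  exact abs_accRate_sub_accRate_le_two_mul_tvDist hq1 hq'1 hp hp1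

/-- **Transfer law, both slots.**  `|acc(p, q) − acc(p', q')| ≤ 2‖p − p'‖_TV + 2‖q − q'‖_TV`.
[folklore] -/
theorem abs_accRate_sub_accRate_le {p p' q q' : X → ℝ} (hp' : ∀ x, 0 ≤ p' x) (hp1 : ∑ x, p x = 1)
    (hp'1 : ∑ x, p' x = 1) (hq : ∀ x, 0 ≤ q x) (hq1 : ∑ x, q x = 1) (hq'1 : ∑ x, q' x = 1) :
    |accRate p q - accRate p' q'| ≤ 2 * tvDist p p' + 2 * tvDist q q' := by
  have h1 := abs_accRate_sub_accRate_le_two_mul_tvDist hp1 hp'1 hq hq1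
  have h2 := abs_accRate_sub_accRate_le_two_mul_tvDist_right hp' hp'1 hq1 hq'1
  calc |accRate p q - accRate p' q'|
      = |(accRate p q - accRate p' q) + (accRate p' q - accRate p' q')| := by congr 1; ring
    _ ≤ |accRate p q - accRate p' q| + |accRate p' q - accRate p' q'| := abs_add_le _ _
    _ ≤ 2 * tvDist p p' + 2 * tvDist q q' := add_le_add h1 h2

/-- **Transfer floor (readable form).**  `acc(p', q) ≥ acc(p, q) − 2‖p − p'‖_TV`: a model that is
accepted at rate `acc(p, q)` against the target `p` is accepted against ANY other target `p'` at rate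
at least `acc(p, q) − 2‖p − p'‖_TV`. [folklore] -/
theorem accRate_sub_two_mul_tvDist_le_accRate {p p' q : X → ℝ} (hp1 : ∑ x, p x = 1)
    (hp'1 : ∑ x, p' x = 1) (hq : ∀ x, 0 ≤ q x) (hq1 : ∑ x, q x = 1) :
    accRate p q - 2 * tvDist p p' ≤ accRate p' q := by
  have h := abs_accRate_sub_accRate_le_two_mul_tvDist hp1 hp'1 hq hq1
  rw [abs_le] at h
  linarith [h.2]

/-! ### Sharpness of the constant `2` -/

/-- The double `min`-sum of the spike law `(c+ε, c−ε, c, …, c)` on `Fin 2 ⊕ Fin n`. -/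
private theorem sum_sum_min_spike (n : ℕ) {c ε : ℝ} (hε : 0 ≤ ε) :
    ∑ x, ∑ y, min (Sum.elim ![c + ε, c - ε] (fun _ : Fin n => c) x)
        (Sum.elim ![c + ε, c - ε] (fun _ : Fin n => c) y) =
      ((n : ℝ) + 2) ^ 2 * c - 2 * ((n : ℝ) + 1) * ε := by
  have e1 : min (c + ε) (c - ε) = c - ε := min_eq_right (by linarith)
  have e2 : min (c - ε) (c + ε) = c - ε := min_eq_left (by linarith)
  have e3 : min (c + ε) c = c := min_eq_right (by linarith)
  have e4 : min c (c + ε) = c := min_eq_left (by linarith)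
  have e5 : min (c - ε) c = c - ε := min_eq_left (by linarith)
  have e6 : min c (c - ε) = c - ε := min_eq_right (by linarith)
  simp only [Fintype.sum_sum_type, Fin.sum_univ_two, Sum.elim_inl, Sum.elim_inr,
    Matrix.cons_val_zero, Matrix.cons_val_one, sum_const, card_univ, Fintype.card_fin,
    nsmul_eq_mul, min_self, e1, e2, e3, e4, e5, e6]
  ring

/-- The spike law sums to `(n+2)·c`. -/
private theorem sum_spike (n : ℕ) (c ε : ℝ) :
    ∑ x, Sum.elim ![c + ε, c - ε] (fun _ : Fin n => c) x = ((n : ℝ) + 2) * c := by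
  simp only [Fintype.sum_sum_type, Fin.sum_univ_two, Sum.elim_inl, Sum.elim_inr,
    Matrix.cons_val_zero, Matrix.cons_val_one, sum_const, card_univ, Fintype.card_fin,
    nsmul_eq_mul]
  ring

/-- The spike law is `ε` away from the constant law `c` in total variation. -/
private theorem tvDist_const_spike (n : ℕ) (c : ℝ) {ε : ℝ} (hε : 0 ≤ ε) :
    tvDist (fun _ : Fin 2 ⊕ Fin n => c) (Sum.elim ![c + ε, c - ε] (fun _ : Fin n => c)) = ε := by
  unfold tvDist
  have e1 : |c - (c + ε)| = ε := by
    rw [show c - (c + ε) = -ε by ring, abs_neg, abs_of_nonneg hε]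
  have e2 : |c - (c - ε)| = ε := by
    rw [show c - (c - ε) = ε by ring, abs_of_nonneg hε]
  simp only [Fintype.sum_sum_type, Fin.sum_univ_two, Sum.elim_inl, Sum.elim_inr,
    Matrix.cons_val_zero, Matrix.cons_val_one, sub_self, abs_zero, sum_const, card_univ,
    Fintype.card_fin, smul_zero, add_zero, e1, e2]
  ring

/-- **Sharpness witness.**  On `Fin 2 ⊕ Fin n` take the target `p` AND the model `q` uniform and
move mass `ε ≤ 1/(n+2)` of the target from one point to another (`p'`): the acceptance drops from
`1` by exactly `2·((n+1)/(n+2))·‖p − p'‖_TV`. [folklore] -/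
theorem accRate_transfer_witness (n : ℕ) {ε : ℝ} (hε : 0 ≤ ε) (hε1 : ε ≤ 1 / ((n : ℝ) + 2)) :
    ∃ p p' q : Fin 2 ⊕ Fin n → ℝ,
      (∀ x, 0 ≤ p x) ∧ (∀ x, 0 ≤ p' x) ∧ (∀ x, 0 ≤ q x) ∧
      ∑ x, p x = 1 ∧ ∑ x, p' x = 1 ∧ ∑ x, q x = 1 ∧
      tvDist p p' = ε ∧ accRate p q = 1 ∧
      accRate p q - accRate p' q = 2 * (((n : ℝ) + 1) / ((n : ℝ) + 2)) * tvDist p p' := by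
  obtain ⟨c, hc⟩ : ∃ c : ℝ, c = 1 / ((n : ℝ) + 2) := ⟨_, rfl⟩
  rw [← hc] at hε1
  have hn : (0 : ℝ) < (n : ℝ) + 2 := by positivity
  have hc0 : 0 < c := by rw [hc]; positivity
  have hcn : ((n : ℝ) + 2) * c = 1 := by rw [hc]; field_simp
  -- the uniform law sums to one and is accepted at rate one against itself
  have hsumc : ∑ _x : Fin 2 ⊕ Fin n, c = 1 := by
    rw [sum_const, card_univ, Fintype.card_sum, Fintype.card_fin, Fintype.card_fin, nsmul_eq_mul]
    push_cast
    linear_combination hcn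
  have hA : accRate (fun _ : Fin 2 ⊕ Fin n => c) (fun _ => c) = 1 := by
    simp only [accRate, min_self, sum_const, card_univ, Fintype.card_sum, Fintype.card_fin,
      nsmul_eq_mul]
    push_cast
    linear_combination (((n : ℝ) + 2) * c + 1) * hcn
  -- the spike law against the uniform model
  have hB : accRate (Sum.elim ![c + ε, c - ε] (fun _ : Fin n => c)) (fun _ => c) =
      (((n : ℝ) + 2) ^ 2 * c - 2 * ((n : ℝ) + 1) * ε) * c := by
    unfold accRate
    simp_rw [← min_mul_of_nonneg _ _ hc0.le, ← sum_mul]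
    rw [sum_sum_min_spike n hε]
  refine ⟨fun _ => c, Sum.elim ![c + ε, c - ε] (fun _ : Fin n => c), fun _ => c,
    fun _ => hc0.le, ?_, fun _ => hc0.le, hsumc, ?_, hsumc, tvDist_const_spike n c hε, hA, ?_⟩
  · -- non-negativity of the spike law (`ε ≤ c`)
    rintro (i | j)
    · fin_cases i
      · simp
        linarith
      · simp
        linarith
    · simp
      exact hc0.le
  · rw [sum_spike, hcn]
  · -- the drop: `1 − ((n+2)²c − 2(n+1)ε)·c = 2(n+1)εc = 2((n+1)/(n+2))·ε`
    rw [tvDist_const_spike n c hε, hA, hB]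
    have e : 2 * (((n : ℝ) + 1) / ((n : ℝ) + 2)) * ε = 2 * ((n : ℝ) + 1) * ε * c := by
      rw [hc]; ring
    rw [e]
    linear_combination (-(((n : ℝ) + 2) * c + 1)) * hcn

/-- **The constant `2` of the transfer law cannot be lowered.**  For every `C < 2` there are
probability vectors `p`, `p'`, `q` on a finite space with `C·‖p − p'‖_TV < |acc(p, q) − acc(p', q)|`.
[folklore] -/
theorem accRate_transfer_two_sharp {C : ℝ} (hC : C < 2) :
    ∃ (n : ℕ) (p p' q : Fin 2 ⊕ Fin n → ℝ),
      (∀ x, 0 ≤ p x) ∧ (∀ x, 0 ≤ p' x) ∧ (∀ x, 0 ≤ q x) ∧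
      ∑ x, p x = 1 ∧ ∑ x, p' x = 1 ∧ ∑ x, q x = 1 ∧
      C * tvDist p p' < |accRate p q - accRate p' q| := by
  obtain ⟨n, hn⟩ := exists_nat_gt (2 / (2 - C))
  have hn2 : (0 : ℝ) < (n : ℝ) + 2 := by positivity
  have hε1 : (1 : ℝ) / ((n : ℝ) + 2) ≤ 1 / ((n : ℝ) + 2) := le_rfl
  obtain ⟨p, p', q, hp, hp', hq, hp1, hp'1, hq1, htv, _, hdrop⟩ :=
    accRate_transfer_witness n (by positivity : (0 : ℝ) ≤ 1 / ((n : ℝ) + 2)) hε1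
  refine ⟨n, p, p', q, hp, hp', hq, hp1, hp'1, hq1, ?_⟩
  have hεpos : 0 < tvDist p p' := by rw [htv]; positivity
  -- `C < 2(n+1)/(n+2)` from `n > 2/(2 − C)`
  have h2C : 0 < 2 - C := by linarith
  have hn' : 2 < (n : ℝ) * (2 - C) := by
    have := (div_lt_iff₀ h2C).mp hn
    linarith
  have hrat : C < 2 * (((n : ℝ) + 1) / ((n : ℝ) + 2)) := by
    rw [mul_div_assoc', lt_div_iff₀ hn2]
    nlinarith
  have hpos : 0 ≤ accRate p q - accRate p' q := by
    rw [hdrop]; positivity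
  rw [abs_of_nonneg hpos, hdrop]
  exact mul_lt_mul_of_pos_right hrat hεpos

/-! ### Transfer along a Gibbs ladder -/

/-- **Pinsker both ways.**  `2‖p − q‖_TV ≤ √(D(p‖q) + D(q‖p))` for positive probability vectors
(from the tree's sharp-constant Pinsker `2·TV² ≤ D` [cite: PolyanskiyWu2024, Thm 7.10], applied in
both directions). -/
theorem two_mul_tvDist_le_sqrt_jeffreys {p q : X → ℝ} (hp : ∀ x, 0 < p x) (hq : ∀ x, 0 < q x)
    (hp1 : ∑ x, p x = 1) (hq1 : ∑ x, q x = 1) :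
    2 * tvDist p q ≤ Real.sqrt (klFin p q + klFin q p) := by
  classical
  have h1 : 2 * tvDist p q ^ 2 ≤ klFin p q :=
    Literature.Probability.Entropy.two_mul_tvDist_sq_le_kl hp hq hp1 hq1
  have h2 : 2 * tvDist q p ^ 2 ≤ klFin q p :=
    Literature.Probability.Entropy.two_mul_tvDist_sq_le_kl hq hp hq1 hp1
  rw [tvDist_comm q p] at h2
  have h0 : 0 ≤ 2 * tvDist p q := mul_nonneg zero_le_two (tvDist_nonneg p q)
  rw [← Real.sqrt_sq h0]
  exact Real.sqrt_le_sqrt (by nlinarith)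

/-- The Jeffreys divergence between two Gibbs laws is the covariance-type sum
`Σ_x (π_{S₀} x − π_{S₁} x)(S₁ x − S₀ x)` (the tree's `jeffreys_gibbs`, two-action form). -/
theorem klFin_add_klFin_gibbsLaw [Nonempty X] (S₀ S₁ : X → ℝ) :
    klFin (gibbsLaw S₀) (gibbsLaw S₁) + klFin (gibbsLaw S₁) (gibbsLaw S₀) =
      ∑ x, (gibbsLaw S₀ x - gibbsLaw S₁ x) * (S₁ x - S₀ x) := by
  have h := jeffreys_gibbs (n := 1) ![S₀, S₁] 0 1
  simpa only [Matrix.cons_val_zero, Matrix.cons_val_one, Matrix.head_cons] using h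

/-- **Acceptance transfer along a Gibbs ladder.**  For actions `S₀`, `S₁` on a finite configuration
space and ANY non-negative normalised model `q`:
`acc(π_{S₁}, q) ≥ acc(π_{S₀}, q) − √(Σ_x (π_{S₀} x − π_{S₁} x)(S₁ x − S₀ x))` — a model trained (to
whatever acceptance) at one coupling is accepted at the next one at a rate smaller by at most the
square root of the Jeffreys divergence between the two Gibbs laws. [folklore] -/
theorem accRate_gibbs_transfer [Nonempty X] (S₀ S₁ : X → ℝ) {q : X → ℝ} (hq : ∀ x, 0 ≤ q x)
    (hq1 : ∑ x, q x = 1) :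
    accRate (gibbsLaw S₀) q -
        Real.sqrt (∑ x, (gibbsLaw S₀ x - gibbsLaw S₁ x) * (S₁ x - S₀ x)) ≤
      accRate (gibbsLaw S₁) q := by
  have h1 := accRate_sub_two_mul_tvDist_le_accRate (sum_gibbsLaw S₀) (sum_gibbsLaw S₁) hq hq1
  have h2 := two_mul_tvDist_le_sqrt_jeffreys (gibbsLaw_pos S₀) (gibbsLaw_pos S₁) (sum_gibbsLaw S₀)
    (sum_gibbsLaw S₁)
  rw [klFin_add_klFin_gibbsLaw] at h2
  linarith

/-- **Acceptance transfer along a LINEAR protocol step** `S₁ = S₀ + h·A`: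
`acc(π_{β+h}, q) ≥ acc(π_β, q) − √(h·(⟨A⟩_β − ⟨A⟩_{β+h}))`; since `⟨A⟩_β − ⟨A⟩_{β+h}` is `h`
times a susceptibility (extensive), the carried-acceptance window is `|h| ≲ Δacc/√(V·χ_A)`.
[folklore] -/
theorem accRate_gibbs_transfer_linear [Nonempty X] (S₀ A : X → ℝ) (h : ℝ) {q : X → ℝ}
    (hq : ∀ x, 0 ≤ q x) (hq1 : ∑ x, q x = 1) :
    accRate (gibbsLaw S₀) q -
        Real.sqrt (h * (∑ x, gibbsLaw S₀ x * A x -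
          ∑ x, gibbsLaw (fun y => S₀ y + h * A y) x * A x)) ≤
      accRate (gibbsLaw (fun y => S₀ y + h * A y)) q := by
  have key := accRate_gibbs_transfer S₀ (fun y => S₀ y + h * A y) hq hq1
  have e : ∑ x, (gibbsLaw S₀ x - gibbsLaw (fun y => S₀ y + h * A y) x) * (S₀ x + h * A x - S₀ x) =
      h * (∑ x, gibbsLaw S₀ x * A x - ∑ x, gibbsLaw (fun y => S₀ y + h * A y) x * A x) := by
    rw [mul_sub, mul_sum, mul_sum, ← sum_sub_distrib]
    exact sum_congr rfl fun x _ => by ring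
  rw [e] at key
  exact key

end Summit.Ventures.LatticeQCDFlow.Theory2
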